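import Mathlib
import Literature.Analysis.FluidPDE.BackwardParticleMap
import Literature.Analysis.FluidPDE.TrajectoryGradientBound
import Literature.Analysis.FluidPDE.ClassicalSolutionGlue
import Literature.Analysis.FluidPDE.ElgindiBlowup
import Literature.Analysis.FluidPDE.VorticityCalculus
import Literature.Analysis.ODE.EvolutionMapAutonomous
import Summits.NavierStokesRegularity.NavierStokesRegularity.Theorems.EulerZoomLiouvillePowerGaugeEulerLiouvilleKelvinPhysical
import Summits.NavierStokesRegularity.NavierStokesRegularity.Theorems.EulerZoomLiouvillePowerGaugeEulerLiouvillePastIrrotational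
import HarnessLib.Audit

/-!
# Crux E `PowerGaugeEulerLiouville` (stmt-NavierStokesRegularity-19832): classical members with an EXPONENTIALLY FADING
# TAME PAST — Lagrangian tools (pathwise Grönwall, two-time Cauchy formula, finite displacement, the kill along an escaped trajectory)

Route `EulerZoomLiouville` (NavierStokesRegularity), crux E = Seregin's power-gauged ancient-Euler Liouville statement.
A CLASSICAL stratum with no self-similarity, symmetry, energy or far-field-decay hypothesis on the velocity ITSELF: a
classical Euler solution `(u, p)` on a past sub-slab `(−∞, T₁)` whose velocity FADES EXPONENTIALLY into the past,
`‖u(t, y)‖ ≤ M e^{ct}` (`c > 0`), and whose velocity GRADIENT is TAME in the breathing variable `z = e^{−ct} y`,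
`‖∇u(t, y)‖ ≤ C (1 + e^{−ct}‖y‖)^{−(1+ε)}` (`ε > 0`), is IRROTATIONAL on `(−∞, T₁)` (sequel `…FadingTamePast`: `FadingPast.curl_eq_zero`, and the member-level
`FadingPast.ae_eq_zero_of_gauge_of_fadingTamePast` via the tree's `PastIrrotational.ae_eq_zero_of_gauge_of_pastIrrotational`);
THIS FILE holds the trajectory-wise tools of the argument.  The LOG-TIME BREATHERS `u(τ, y) = e^{cτ} V(e^{−cτ} y)` with
`c > 0` and a tame profile `‖∇V(z)‖ ≤ C(1+‖z‖)^{−(1+ε)}` of line `logtime-breathers` (crux dir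
`Cruxes/PowerGaugeEulerLiouville/Lines/logtime-breathers.md`, stub T2b `stub_tameBreather`) are exactly of this form
(sequel `…LogtimeBreatherTame`).

MECHANISM (Lagrangian, physical variables — no profile equation is needed).  Fix `τ < T₁` and `x`, and follow the fluid
particle `P(r) = φ(r, τ, x)` backward.  Since `‖P′(r)‖ ≤ M e^{cr}` is integrable on `(−∞, τ]`, the particle has travelled a
finite distance: `‖P(r) − P(r₁)‖ ≤ (M/c) e^{c r₁}` for `r ≤ r₁` (`FadingPast.norm_evolutionMap_sub_le`).  EITHER the
particle is TRAPPED, `‖P(r)‖ ≤ (M/c) e^{cr}` for every `r ≤ τ` — the trapped set `T_τ` is closed and, being squeezed by the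
volume-preserving maps `φ(r, τ, ·)` into the balls `B(0, (M/c)e^{cr})`, `r → −∞`, is Lebesgue-NULL
(`FadingPast.volume_trapped_eq_zero`) — OR at some time `r₁ ≤ τ` it is outside that ball, and then it stays at distance
`≥ δ > 0` from the origin for all `r ≤ r₁`, where the tame bound gives the INTEGRABLE stretching rate
`‖∇u(r, P(r))‖ ≤ C δ^{−(1+ε)} e^{(1+ε)cr}` and the vanishing source `‖ω(σ, P(σ))‖ ≤ 4‖∇u(σ, P(σ))‖ → 0`; the Cauchy formula
`ω(r₁, P(r₁)) = ∇φ(r₁, σ, ·)(P(σ)) ω(σ, P(σ))` with the PATHWISE Grönwall bound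
`‖∇φ(r₁, σ, ·)(P(σ))‖ ≤ exp ∫_σ^{r₁} ‖∇u(r, P(r))‖ dr` (`FadingPast.norm_fderiv_evolutionMap_le_exp_integral_path`) gives
`ω(r₁, P(r₁)) = 0` as `σ → −∞` (`FadingPast.curl_eq_zero_of_escape`), and the Cauchy formula from `r₁` to `τ` transports the
zero (`FadingPast.curl_eq_zero_of_curl_eq_zero_earlier`).  So `curl u(τ) = 0` off the null closed set `T_τ`, hence everywhere
by continuity.

WHAT THIS IS NOT: not NS regularity, not the crux E — a classical stratum for the lead skeleton
`Cruxes/PowerGaugeEulerLiouville/Lines/birth.lean` (interim LEAD ns-typeII-p2 g10). [folklore; MajdaBertozziCUP2002 §1.6 Prop 1.8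
(1.51), §2.5 (2.115)–(2.117), §4.2 (4.46)–(4.47); line card `Lines/logtime-breathers.md` T2b]
-/

noncomputable section

set_option linter.dupNamespace false

open MeasureTheory Set Filter Topology Metric Function
open scoped NNReal ENNReal ContDiff

namespace Summit.NavierStokesRegularity.NavierStokesRegularity.Theorems.PowerGaugeEulerLiouville.FadingPast

open Literature.Analysis Literature.Analysis.FluidPDE

/-! ### Two Lagrangian tools for a classical flow on a time set `S` -/

section Tools

variable {S : Set ℝ} {u : ℝ → EuclideanSpace ℝ (Fin 3) → EuclideanSpace ℝ (Fin 3)}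
  {p : ℝ → EuclideanSpace ℝ (Fin 3) → ℝ} {t₀ t : ℝ}

/-- **PATHWISE Grönwall bound on the trajectory gradient**: if `‖∇u(s, φ(s, t₀, a))‖ ≤ M(s)` ALONG THE TRAJECTORY of `a`
for all times `s` between `t₀` and `t` (both in `S`), `M` continuous there, then `‖∇φ(t, t₀, ·)(a)‖ ≤ exp |∫_{t₀}^t M|`
(the tree's `norm_fderiv_evolutionMap_le_exp_abs_integral` asks for the bound at every point of space; its proof uses it only
along the trajectory). [cite: MajdaBertozziCUP2002, §4.2 eq. (4.47); Hartman2002, Ch. IV Lemma 4.1 eq. (4.2)] -/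
theorem norm_fderiv_evolutionMap_le_exp_integral_path (hL : ODE.IsUniformlyLipschitzOn u S)
    (hu : IsSmoothSpaceTimeOn S u) (hS : Convex ℝ S) (hU : UniqueDiffOn ℝ S) (ht₀ : t₀ ∈ S)
    (ht : t ∈ S) (a : EuclideanSpace ℝ (Fin 3)) {M : ℝ → ℝ} (hMc : ContinuousOn M (uIcc t₀ t))
    (hM : ∀ s ∈ uIcc t₀ t, ‖fderiv ℝ (u s) (ODE.evolutionMap u t₀ s a)‖ ≤ M s) :
    ‖fderiv ℝ (ODE.evolutionMap u t₀ t) a‖ ≤ Real.exp |∫ s in t₀..t, M s| := by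
  -- adapted from Literature/Analysis/FluidPDE/TrajectoryGradientBound.lean (`norm_fderiv_evolutionMap_le_exp_abs_integral`)
  have hsub := hS.ordConnected.uIcc_subset ht₀ ht
  have h := ODE.norm_le_mul_exp_abs_integral_of_norm_deriv_le_uIcc (M := M)
    (g := fun r => fderiv ℝ (ODE.evolutionMap u t₀ r) a)
    (g' := fun r => (fderiv ℝ (u r) (ODE.evolutionMap u t₀ r a)).comp
      (fderiv ℝ (ODE.evolutionMap u t₀ r) a))
    (fun s hs => (hasDerivWithinAt_fderiv_evolutionMap hL hu hS hU ht₀ (hsub hs) a).mono hsub)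
    hMc (fun s hs => (ContinuousLinearMap.opNorm_comp_le _ _).trans
      (mul_le_mul_of_nonneg_right (hM s hs) (norm_nonneg _)))
  rw [fderiv_evolutionMap_self] at h
  exact h.trans (mul_le_of_le_one_left (Real.exp_nonneg _) ContinuousLinearMap.norm_id_le)

/-- **Two-time Cauchy formula in Eulerian form** for a classical Euler flow on `S = (−∞, T₁)` whose velocity gradient is
bounded on the slab (`‖∇u‖ ≤ K`): for `t₀ ≤ t < T₁`,
`ω(t, x) = ∇φ(t, t₀, ·)(a) · ω(t₀, a)` with `a = φ(t₀, t, x)` (time translation of the tree's base-time-`0` formula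
`IsClassicalNSSolutionOn.curl_eq_fderiv_evolutionMap_apply`). [cite: MajdaBertozziCUP2002, §2.5 (2.115)–(2.117); §1.6 Prop. 1.8 (1.51)] -/
theorem curl_eq_fderiv_evolutionMap_apply_two_time {T₁ : ℝ} (hcl : IsClassicalEulerSolutionOn (Iio T₁) 0 u p)
    {K : ℝ≥0} (hK : ∀ s : ℝ, s < T₁ → LipschitzWith K (u s)) (ht₀ : t₀ < T₁) (ht : t < T₁)
    (x : EuclideanSpace ℝ (Fin 3)) :
    curl (u t) x = fderiv ℝ (ODE.evolutionMap u t₀ t) (ODE.evolutionMap u t t₀ x)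
      (curl (u t₀) (ODE.evolutionMap u t t₀ x)) := by
  -- the translated flow `v s = u (s + t₀)` on `(−∞, T₁ − t₀) ∋ 0`
  set v : ℝ → EuclideanSpace ℝ (Fin 3) → EuclideanSpace ℝ (Fin 3) := fun s => u (s + t₀) with hv
  set q : ℝ → EuclideanSpace ℝ (Fin 3) → ℝ := fun s => p (s + t₀) with hq
  set S' : Set ℝ := Iio (T₁ - t₀) with hS'
  have hclv : IsClassicalEulerSolutionOn S' 0 v q := by
    have h1 := hcl.comp_add_right t₀
    refine h1.mono (fun s hs => ?_) (uniqueDiffOn_Iio _)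
    show s + t₀ < T₁
    rw [hS', mem_Iio] at hs
    linarith
  have hS'c : Convex ℝ S' := convex_Iio _
  have hU' : UniqueDiffOn ℝ S' := uniqueDiffOn_Iio _
  have h0 : (0 : ℝ) ∈ S' := by rw [hS', mem_Iio]; linarith
  have htS' : t - t₀ ∈ S' := by rw [hS', mem_Iio]; linarith
  have hLv : ODE.IsUniformlyLipschitzOn v S' := by
    refine hclv.smooth_velocity.isUniformlyLipschitzOn_of_norm_fderiv_le fun C _ hCS => ⟨K, fun s hs y => ?_⟩
    have hs' : s + t₀ < T₁ := by have := hCS hs; rw [hS', mem_Iio] at this; linarith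
    exact norm_fderiv_le_of_lipschitz ℝ (hK _ hs')
  -- the base-`0` Cauchy formula for `v` at time `t - t₀`
  have hcauchy := hclv.curl_eq_fderiv_evolutionMap_apply hS'c h0 hU' hLv htS' x
  -- the flows of `v` and `u` agree up to the time shift
  have hlipI : ∀ a b : ℝ, a < T₁ → b < T₁ → ∀ s ∈ uIcc a b, LipschitzWith K (u s) := by
    intro a b ha hb s hs
    refine hK s ?_
    rcases mem_uIcc.1 hs with ⟨_, h2⟩ | ⟨_, h2⟩
    · exact lt_of_le_of_lt h2 hb
    · exact lt_of_le_of_lt h2 ha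
  have hfw : ODE.evolutionMap v 0 (t - t₀) = ODE.evolutionMap u t₀ t := by
    funext y
    have h := ODE.evolutionMap_comp_add_right (v := u) (t₀ := (0 : ℝ)) (t := t - t₀) t₀
      (hlipI _ _ (by linarith) (by linarith)) y
    simpa only [zero_add, sub_add_cancel] using h
  have hbw : ODE.evolutionMap v (t - t₀) 0 = ODE.evolutionMap u t t₀ := by
    funext y
    have h := ODE.evolutionMap_comp_add_right (v := u) (t₀ := t - t₀) (t := (0 : ℝ)) t₀
      (hlipI _ _ (by linarith) (by linarith)) y
    simpa only [zero_add, sub_add_cancel] using h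
  have hvt : v (t - t₀) = u t := by simp [hv]
  have hv0 : v 0 = u t₀ := by simp [hv]
  rw [hfw, hbw, hvt, hv0] at hcauchy
  exact hcauchy

/-- **Transport of a vorticity zero forward along a trajectory**: under the hypotheses of
`curl_eq_fderiv_evolutionMap_apply_two_time`, if `ω(t₀, φ(t₀, t, x)) = 0` for some `t₀ ≤ t`... (any `t₀, t < T₁`), then
`ω(t, x) = 0` (the Cauchy formula is linear in the initial vorticity). [cite: MajdaBertozziCUP2002, §1.6 Prop. 1.8 (1.51)] -/
theorem curl_eq_zero_of_curl_eq_zero_earlier {T₁ : ℝ} (hcl : IsClassicalEulerSolutionOn (Iio T₁) 0 u p)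
    {K : ℝ≥0} (hK : ∀ s : ℝ, s < T₁ → LipschitzWith K (u s)) (ht₀ : t₀ < T₁) (ht : t < T₁)
    (x : EuclideanSpace ℝ (Fin 3)) (h0 : curl (u t₀) (ODE.evolutionMap u t t₀ x) = 0) :
    curl (u t) x = 0 := by
  rw [curl_eq_fderiv_evolutionMap_apply_two_time hcl hK ht₀ ht x, h0, map_zero]

/-- **Vorticity bound along one trajectory**: under the same hypotheses, with `a = φ(t₀, t, x)` and a continuous PATHWISE
bound `‖∇u(s, φ(s, t₀, a))‖ ≤ M(s)` for `s` between `t₀` and `t`,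
`‖ω(t, x)‖ ≤ exp |∫_{t₀}^t M| · ‖ω(t₀, a)‖`. [cite: MajdaBertozziCUP2002, §2.5 (2.115)–(2.117), §4.2 (4.47)] -/
theorem norm_curl_le_exp_integral_path {T₁ : ℝ} (hcl : IsClassicalEulerSolutionOn (Iio T₁) 0 u p)
    {K : ℝ≥0} (hK : ∀ s : ℝ, s < T₁ → LipschitzWith K (u s))
    (hL : ODE.IsUniformlyLipschitzOn u (Iio T₁)) (ht₀ : t₀ < T₁) (ht : t < T₁)
    (x : EuclideanSpace ℝ (Fin 3)) {M : ℝ → ℝ} (hMc : ContinuousOn M (uIcc t₀ t))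
    (hM : ∀ s ∈ uIcc t₀ t, ‖fderiv ℝ (u s) (ODE.evolutionMap u t₀ s (ODE.evolutionMap u t t₀ x))‖ ≤ M s) :
    ‖curl (u t) x‖ ≤ Real.exp |∫ s in t₀..t, M s| * ‖curl (u t₀) (ODE.evolutionMap u t t₀ x)‖ := by
  rw [curl_eq_fderiv_evolutionMap_apply_two_time hcl hK ht₀ ht x]
  refine (ContinuousLinearMap.le_opNorm _ _).trans ?_
  gcongr
  exact norm_fderiv_evolutionMap_le_exp_integral_path hL hcl.smooth_velocity (convex_Iio _) (uniqueDiffOn_Iio _)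
    ht₀ ht _ hMc hM

end Tools

/-! ### The fading tame past -/

section Fading

variable {u : ℝ → EuclideanSpace ℝ (Fin 3) → EuclideanSpace ℝ (Fin 3)} {p : ℝ → EuclideanSpace ℝ (Fin 3) → ℝ}
  {T₁ c M C ε : ℝ}

/-- The gradient bound `C (1 + w)^{−(1+ε)}` with `w ≥ 0` is at most `C`; in particular `C ≥ 0` and every slice is
`C`-Lipschitz. [folklore] -/
theorem norm_fderiv_le_const (hcl : IsClassicalEulerSolutionOn (Iio T₁) 0 u p) (hε : 0 < ε)
    (hgrad : ∀ s : ℝ, s < T₁ → ∀ y, ‖fderiv ℝ (u s) y‖ ≤ C * (1 + Real.exp (-(c * s)) * ‖y‖) ^ (-(1 + ε)))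
    {s : ℝ} (hs : s < T₁) (y : EuclideanSpace ℝ (Fin 3)) : ‖fderiv ℝ (u s) y‖ ≤ C := by
  have hC0 : 0 ≤ C := by
    have h := hgrad s hs 0
    rw [norm_zero, mul_zero, add_zero, Real.one_rpow, mul_one] at h
    exact (norm_nonneg _).trans h
  have _ := hcl
  refine (hgrad s hs y).trans ?_
  have h1 : (1 + Real.exp (-(c * s)) * ‖y‖) ^ (-(1 + ε)) ≤ 1 :=
    Real.rpow_le_one_of_one_le_of_nonpos (by nlinarith [Real.exp_pos (-(c * s)), norm_nonneg y]) (by linarith)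
  nlinarith

/-- The slices are `C`-Lipschitz and the Cauchy–Lipschitz hypotheses hold on `(−∞, T₁)`. [folklore] -/
theorem lipschitz_and_isUniformlyLipschitzOn (hcl : IsClassicalEulerSolutionOn (Iio T₁) 0 u p) (hε : 0 < ε)
    (hgrad : ∀ s : ℝ, s < T₁ → ∀ y, ‖fderiv ℝ (u s) y‖ ≤ C * (1 + Real.exp (-(c * s)) * ‖y‖) ^ (-(1 + ε))) :
    ∃ K : ℝ≥0, (∀ s : ℝ, s < T₁ → LipschitzWith K (u s)) ∧ ODE.IsUniformlyLipschitzOn u (Iio T₁) := by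
  have hC0 : 0 ≤ C := by
    obtain ⟨s, hs⟩ := exists_lt T₁
    exact (norm_nonneg _).trans (norm_fderiv_le_const hcl hε hgrad hs 0)
  refine ⟨⟨C, hC0⟩, fun s hs => ?_, ?_⟩
  · refine lipschitzWith_of_nnnorm_fderiv_le ((hcl.contDiff_velocity hs).differentiable (by simp)) fun y => ?_
    have h : (‖fderiv ℝ (u s) y‖₊ : ℝ) ≤ C := by rw [coe_nnnorm]; exact norm_fderiv_le_const hcl hε hgrad hs y
    exact_mod_cast h
  · exact hcl.smooth_velocity.isUniformlyLipschitzOn_of_norm_fderiv_le fun K _ hKS =>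
      ⟨C, fun s hs y => norm_fderiv_le_const hcl hε hgrad (hKS hs) y⟩

/-- **Finite backward displacement**: with `‖u(s, ·)‖ ≤ M e^{cs}` (`c > 0`), a fluid particle moves by at most
`(M/c) e^{c r₁}` between the times `r ≤ r₁ < T₁`: `‖φ(r, r₁, y) − y‖ ≤ (M/c) e^{c r₁}`.
[cite: MajdaBertozziCUP2002, §4.2 eq. (4.46)] -/
theorem norm_evolutionMap_sub_le (hL : ODE.IsUniformlyLipschitzOn u (Iio T₁)) (hc : 0 < c)
    (hvel : ∀ s : ℝ, s < T₁ → ∀ y, ‖u s y‖ ≤ M * Real.exp (c * s))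
    {r₁ r : ℝ} (hr₁ : r₁ < T₁) (hr : r ≤ r₁) (y : EuclideanSpace ℝ (Fin 3)) :
    ‖ODE.evolutionMap u r₁ r y - y‖ ≤ M / c * Real.exp (c * r₁) := by
  have hrT : r < T₁ := lt_of_le_of_lt hr hr₁
  have hM0 : 0 ≤ M := by
    have h := hvel r₁ hr₁ 0
    exact le_of_mul_le_mul_right ((norm_nonneg _).trans h |> le_trans (by simp)) (Real.exp_pos (c * r₁))
  have hsub : uIcc r₁ r ⊆ Iio T₁ := (convex_Iio T₁).ordConnected.uIcc_subset hr₁ hrT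
  have h1 := norm_evolutionMap_sub_self_le_abs_integral hL (convex_Iio _) hr₁ hrT
    (V := fun s => M * Real.exp (c * s)) (by fun_prop) (fun s hs z => hvel s (hsub hs) z) y
  refine h1.trans ?_
  have hint : ∫ s in r₁..r, M * Real.exp (c * s) = M * (c⁻¹ * (Real.exp (c * r) - Real.exp (c * r₁))) := by
    rw [intervalIntegral.integral_const_mul, intervalIntegral.integral_comp_mul_left _ hc.ne', integral_exp, smul_eq_mul]
  rw [hint]
  have hle : Real.exp (c * r) ≤ Real.exp (c * r₁) := Real.exp_le_exp.2 (by nlinarith)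
  have hval : M * (c⁻¹ * (Real.exp (c * r) - Real.exp (c * r₁))) ≤ 0 := by
    have : c⁻¹ * (Real.exp (c * r) - Real.exp (c * r₁)) ≤ 0 :=
      mul_nonpos_of_nonneg_of_nonpos (inv_nonneg.2 hc.le) (by linarith)
    exact mul_nonpos_of_nonneg_of_nonpos hM0 this |>.trans le_rfl |> fun h => by nlinarith
  rw [abs_of_nonpos hval]
  have hpos : 0 ≤ Real.exp (c * r) := (Real.exp_pos _).le
  rw [div_eq_mul_inv]
  nlinarith [mul_nonneg hM0 (inv_nonneg.2 hc.le), mul_nonneg (mul_nonneg hM0 (inv_nonneg.2 hc.le)) hpos]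

/-- **KILL ALONG AN ESCAPED TRAJECTORY.**  If the fluid particle sitting at `x₁` at time `r₁ < T₁` stays at distance
`≥ δ > 0` from the origin at all earlier times, `‖φ(r, r₁, x₁)‖ ≥ δ` for `r ≤ r₁`, then `ω(r₁, x₁) = 0`: along the
trajectory the tame bound gives the integrable stretching rate `‖∇u(r, φ(r, r₁, x₁))‖ ≤ C δ^{−(1+ε)} e^{(1+ε)cr}` and the
vanishing source `‖ω(σ, φ(σ, r₁, x₁))‖ ≤ 4 C δ^{−(1+ε)} e^{(1+ε)cσ}`, so the Cauchy formula from `σ` to `r₁` gives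
`‖ω(r₁, x₁)‖ ≤ A e^{(1+ε)cσ} → 0` as `σ → −∞`. [folklore; MajdaBertozziCUP2002 §2.5 (2.117), §4.2 (4.47)] -/
theorem curl_eq_zero_of_escape (hcl : IsClassicalEulerSolutionOn (Iio T₁) 0 u p) (hc : 0 < c) (hε : 0 < ε)
    (hgrad : ∀ s : ℝ, s < T₁ → ∀ y, ‖fderiv ℝ (u s) y‖ ≤ C * (1 + Real.exp (-(c * s)) * ‖y‖) ^ (-(1 + ε)))
    {r₁ : ℝ} (hr₁ : r₁ < T₁) (x₁ : EuclideanSpace ℝ (Fin 3)) {δ : ℝ} (hδ : 0 < δ)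
    (hfar : ∀ r : ℝ, r ≤ r₁ → δ ≤ ‖ODE.evolutionMap u r₁ r x₁‖) :
    curl (u r₁) x₁ = 0 := by
  obtain ⟨K, hK, hL⟩ := lipschitz_and_isUniformlyLipschitzOn hcl hε hgrad
  have hC0 : 0 ≤ C := (norm_nonneg _).trans (norm_fderiv_le_const hcl hε hgrad hr₁ 0)
  have hS : Convex ℝ (Iio T₁) := convex_Iio _
  set k : ℝ := (1 + ε) * c with hk
  have hk0 : 0 < k := by positivity
  set D : ℝ := C * δ ^ (-(1 + ε)) with hD
  have hD0 : 0 ≤ D := mul_nonneg hC0 (Real.rpow_nonneg hδ.le _)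
  -- the tame bound at a point of norm `≥ δ`
  have htame : ∀ s : ℝ, s < T₁ → ∀ y : EuclideanSpace ℝ (Fin 3), δ ≤ ‖y‖ →
      ‖fderiv ℝ (u s) y‖ ≤ D * Real.exp (k * s) := by
    intro s hs y hy
    refine (hgrad s hs y).trans ?_
    have hE : 0 < Real.exp (-(c * s)) := Real.exp_pos _
    have hbase : Real.exp (-(c * s)) * δ ≤ 1 + Real.exp (-(c * s)) * ‖y‖ := by nlinarith
    have h1 : (1 + Real.exp (-(c * s)) * ‖y‖) ^ (-(1 + ε)) ≤ (Real.exp (-(c * s)) * δ) ^ (-(1 + ε)) :=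
      Real.rpow_le_rpow_of_nonpos (by positivity) hbase (by linarith)
    have h2 : (Real.exp (-(c * s)) * δ) ^ (-(1 + ε)) = δ ^ (-(1 + ε)) * Real.exp (k * s) := by
      rw [Real.mul_rpow hE.le hδ.le, ← Real.exp_mul, mul_comm]
      congr 2
      rw [hk]; ring
    rw [hD, mul_assoc]
    exact mul_le_mul_of_nonneg_left (h1.trans h2.le) hC0
  -- the bound for every `σ < r₁`
  set A : ℝ := Real.exp (D * k⁻¹ * Real.exp (k * r₁)) * (4 * D) with hA
  have hbound : ∀ σ : ℝ, σ < r₁ → ‖curl (u r₁) x₁‖ ≤ A * Real.exp (k * σ) := by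
    intro σ hσ
    have hσT : σ < T₁ := hσ.trans hr₁
    -- pathwise rate along `s ↦ φ(s, σ, φ(σ, r₁, x₁)) = φ(s, r₁, x₁)`
    have hpath : ∀ s ∈ uIcc σ r₁,
        ‖fderiv ℝ (u s) (ODE.evolutionMap u σ s (ODE.evolutionMap u r₁ σ x₁))‖ ≤ D * Real.exp (k * s) := by
      intro s hs
      rw [uIcc_of_le hσ.le] at hs
      have hsT : s < T₁ := lt_of_le_of_lt hs.2 hr₁
      rw [hL.evolutionMap_trans hS hr₁ hσT hsT]
      exact htame s hsT _ (hfar s hs.2)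
    have h1 := norm_curl_le_exp_integral_path hcl hK hL hσT hr₁ x₁ (M := fun s => D * Real.exp (k * s))
      (by fun_prop) hpath
    -- the source at time `σ`
    have hsrc : ‖curl (u σ) (ODE.evolutionMap u r₁ σ x₁)‖ ≤ 4 * (D * Real.exp (k * σ)) :=
      (norm_curl_le_four_mul _ _).trans
        (mul_le_mul_of_nonneg_left (htame σ hσT _ (hfar σ hσ.le)) (by norm_num))
    -- the integral of the rate
    have hint : ∫ s in σ..r₁, D * Real.exp (k * s) = D * (k⁻¹ * (Real.exp (k * r₁) - Real.exp (k * σ))) := by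
      rw [intervalIntegral.integral_const_mul, intervalIntegral.integral_comp_mul_left _ hk0.ne', integral_exp,
        smul_eq_mul]
    have hint_le : |∫ s in σ..r₁, D * Real.exp (k * s)| ≤ D * k⁻¹ * Real.exp (k * r₁) := by
      rw [hint]
      have hnn : 0 ≤ D * (k⁻¹ * (Real.exp (k * r₁) - Real.exp (k * σ))) := by
        refine mul_nonneg hD0 (mul_nonneg (inv_nonneg.2 hk0.le) ?_)
        have := Real.exp_le_exp.2 (show k * σ ≤ k * r₁ by nlinarith)
        linarith
      rw [abs_of_nonneg hnn]
      nlinarith [Real.exp_pos (k * σ), mul_nonneg hD0 (inv_nonneg.2 hk0.le)]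
    calc ‖curl (u r₁) x₁‖
        ≤ Real.exp |∫ s in σ..r₁, D * Real.exp (k * s)| * ‖curl (u σ) (ODE.evolutionMap u r₁ σ x₁)‖ := h1
      _ ≤ Real.exp (D * k⁻¹ * Real.exp (k * r₁)) * (4 * (D * Real.exp (k * σ))) := by
          gcongr
      _ = A * Real.exp (k * σ) := by rw [hA]; ring
  -- let `σ → −∞`
  have hlim : Tendsto (fun σ : ℝ => A * Real.exp (k * σ)) atBot (𝓝 0) := by
    have h1 : Tendsto (fun σ : ℝ => k * σ) atBot atBot := tendsto_id.const_mul_atBot hk0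
    have h2 := (Real.tendsto_exp_atBot.comp h1).const_mul A
    simpa using h2
  rw [← norm_le_zero_iff]
  exact ge_of_tendsto hlim ((eventually_lt_atBot r₁).mono fun σ hσ => hbound σ hσ)

end Fading

end Summit.NavierStokesRegularity.NavierStokesRegularity.Theorems.PowerGaugeEulerLiouville.FadingPast
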